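import Literature.AnabelianGeometry.SemiGraphs.TemperedGroups
import Mathlib.Topology.Algebra.Group.Quotient
import Mathlib.Tactic.Group
import HarnessLib

/-!
# The inverse-limit hypotheses of [SemiAnbd] Thm 6.6's proof hold in a tempered group

Mochizuki, *Semi-graphs of anabelioids*, Publ. RIMS **42** (2006) [SemiAnbd]: Definition 3.1 (i)
(tempered topological groups = inverse limits of countable discrete groups, author's manuscript
p. 33; the tree's `IsTempered`, `TemperedGroups.lean`) and the proof of Theorem 6.6 (p. 73,
"by passing to the corresponding inverse limit"). [cite: MochizukiSemiAnbd2006, Thm 6.6 proof p.73]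

Proof-only companion of `QuotientIsoSystemLift.lean` (abc-iut sub-DAG
`plan/L3/SUBDAG-SemiAnbd-Thm66.md`, rows L05/L08): the two "limit" hypotheses under which the
abstract inverse-limit theorem `QuotientIsoSystemLift.exists_continuousMulEquiv_liesUnder` lifts a
compatible system of quotient isomorphisms `T/J_n ⥲ T′/J′_n` to `T ⥲ T′` —

* the INITIAL-TOPOLOGY property (every neighbourhood of `1` in `T` contains the inverse image of
  a neighbourhood of `1` in some `T ⧸ J n`), and
* COMPLETENESS (every sequence coherent modulo the `J n` is the sequence of residues of one
  element) —

are THEOREMS for a tempered group `T` (`IsTempered T`) and any decreasing sequence of closed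
(normal) subgroups `J n` that is *cofinal below the open normal subgroups* (every open normal
subgroup of `T` contains some `J n`).  In the geometric situation of p. 73 (`T = Π^temp_{X_K}`,
`J n = J_X(H_n)` the kernels attached to the tempered coverings of the special-fibre semi-graphs
`𝒢^c_{H_n}`), cofinality is the statement that every open normal subgroup of `Π^temp_{X_K}` contains
some `J_X(H)` — the content of "`Π^temp_{X_K} = lim_H Π^temp_{X_K}/J_X(H)`".  Hence the fields
`initial_JX/JY`, `complete_JX/JY` of `TemperedCurve.SpecializationIsoSystem`
(`TemperedAnabelianThm66Sub.lean`) are supplied by `IsTempered` + cofinality.  Classical; nothing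
here concerns the disputed parts of inter-universal Teichmüller theory or takes a side on
[IUTchIII] Cor. 3.12.
-/

namespace Literature.AnabelianGeometry.SemiGraphs

namespace QuotientIsoSystemLift

open _root_.Topology _root_.Filter

universe u

variable {T : Type u} [Group T] [TopologicalSpace T] [IsTopologicalGroup T]

/-- **Initial topology from temperedness** ([SemiAnbd] Def 3.1 (i) p. 33 + Thm 6.6 proof p. 73):
if `T` is tempered and every open normal subgroup of `T` contains some `J n`, then every open
neighbourhood of `1` in `T` contains `π_n⁻¹(W)` for some `n` and some open neighbourhood `W` of `1`
in `T ⧸ J n` (the hypothesis `initX`/`initY` of `exists_continuousMulEquiv_liesUnder`).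
[cite: MochizukiSemiAnbd2006, Thm 6.6 proof p.73] -/
theorem initial_of_isTempered (hT : IsTempered T) (J : ℕ → Subgroup T)
    (hJ : ∀ N : OpenNormalSubgroup T, ∃ n, J n ≤ N.toSubgroup) :
    ∀ U : Set T, IsOpen U → (1 : T) ∈ U →
      ∃ n, ∃ W : Set (T ⧸ J n), IsOpen W ∧ ((1 : T) : T ⧸ J n) ∈ W ∧
        QuotientGroup.mk ⁻¹' W ⊆ U := by
  intro U hUo h1U
  obtain ⟨N, -, hNU⟩ := hT.basis U (hUo.mem_nhds h1U)
  obtain ⟨n, hn⟩ := hJ N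
  refine ⟨n, QuotientGroup.mk '' (N : Set T), QuotientGroup.isOpenMap_coe _ N.isOpen,
    ⟨1, N.toSubgroup.one_mem, rfl⟩, ?_⟩
  rintro t ⟨m, hm, hmt⟩
  -- `↑m = ↑t` in `T ⧸ J n` with `m ∈ N` and `J n ≤ N` forces `t ∈ N ⊆ U`
  apply hNU
  have h : m⁻¹ * t ∈ J n := QuotientGroup.eq.mp hmt
  have : m * (m⁻¹ * t) ∈ N.toSubgroup := N.toSubgroup.mul_mem hm (hn h)
  show t ∈ N.toSubgroup
  simpa using this

omit [TopologicalSpace T] [IsTopologicalGroup T] in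
/-- In a sequence coherent modulo a decreasing family `J`, later terms are congruent to earlier
ones modulo the earlier subgroup: `(s n)⁻¹ * s m ∈ J n` for `n ≤ m`. [folklore] -/
private theorem coherent_le {J : ℕ → Subgroup T} (hanti : Antitone J) {s : ℕ → T}
    (hs : ∀ n, (s n)⁻¹ * s (n + 1) ∈ J n) {n m : ℕ} (h : n ≤ m) : (s n)⁻¹ * s m ∈ J n := by
  induction h with
  | refl => simp
  | step hle ih =>
    rename_i m
    have h2 : (s m)⁻¹ * s (m + 1) ∈ J n := hanti hle (hs m)
    have : (s n)⁻¹ * s m * ((s m)⁻¹ * s (m + 1)) ∈ J n := (J n).mul_mem ih h2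
    simpa [mul_assoc] using this

/-- **Completeness from temperedness** ([SemiAnbd] Def 3.1 (i) p. 33 + Thm 6.6 proof p. 73): if
`T` is tempered, the `J n` are closed and decreasing, and every open normal subgroup of `T`
contains some `J n`, then every sequence `s` with `(s n)⁻¹ s (n+1) ∈ J n` is the sequence of
residues of one element `t` (`t⁻¹ s n ∈ J n` for all `n`) — the hypothesis `complX`/`complY` of
`exists_continuousMulEquiv_liesUnder`.  Proof: the cosets `s(n_N) N` (`J (n_N) ≤ N`) form a
compatible family over the open normal subgroups; temperedness gives `t`; closedness of `J n` and
the neighbourhood basis of open normal subgroups give `t⁻¹ s n ∈ J n`.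
[cite: MochizukiSemiAnbd2006, Thm 6.6 proof p.73] -/
theorem complete_of_isTempered (hT : IsTempered T) (J : ℕ → Subgroup T)
    (hJc : ∀ n, IsClosed (J n : Set T)) (hanti : Antitone J)
    (hJ : ∀ N : OpenNormalSubgroup T, ∃ n, J n ≤ N.toSubgroup) :
    ∀ s : ℕ → T, (∀ n, (s n)⁻¹ * s (n + 1) ∈ J n) → ∃ t : T, ∀ n, t⁻¹ * s n ∈ J n := by
  intro s hs
  classical
  choose idx hidx using hJ
  -- the compatible family of cosets `x N := s (idx N) · N`
  let x : (N : OpenNormalSubgroup T) → T ⧸ N.toSubgroup := fun N => (s (idx N) : T ⧸ N.toSubgroup)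
  have hcompat : ∀ N M : OpenNormalSubgroup T, N ≤ M → ∀ g : T,
      x N = (g : T ⧸ N.toSubgroup) → x M = (g : T ⧸ M.toSubgroup) := by
    intro N M hNM g hg
    have hNM' : N.toSubgroup ≤ M.toSubgroup := hNM
    -- `s (idx N) ≡ g mod N`
    have h1 : (s (idx N))⁻¹ * g ∈ N.toSubgroup := QuotientGroup.eq.mp hg
    -- `s (idx M) ≡ s (idx N)` modulo `J (min)` which lies in `M`
    have h2 : (s (idx M))⁻¹ * s (idx N) ∈ M.toSubgroup := by
      rcases le_total (idx M) (idx N) with h | h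
      · exact hidx M (coherent_le hanti hs h)
      · have h3 : (s (idx N))⁻¹ * s (idx M) ∈ N.toSubgroup := hidx N (coherent_le hanti hs h)
        have h4 := hNM' (N.toSubgroup.inv_mem h3)
        simpa using h4
    change (s (idx M) : T ⧸ M.toSubgroup) = (g : T ⧸ M.toSubgroup)
    rw [QuotientGroup.eq]
    have : (s (idx M))⁻¹ * s (idx N) * ((s (idx N))⁻¹ * g) ∈ M.toSubgroup :=
      M.toSubgroup.mul_mem h2 (hNM' h1)
    simpa [mul_assoc] using this
  obtain ⟨t, ht⟩ := hT.complete x hcompat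
  refine ⟨t, fun n => ?_⟩
  -- `t⁻¹ s n` lies in `N · J n` for every open normal `N`; since `J n` is closed, it lies in `J n`
  by_contra hnot
  have hopen : IsOpen ((J n : Set T)ᶜ) := (hJc n).isOpen_compl
  -- a neighbourhood `(t⁻¹ s n) · N` of `t⁻¹ s n` inside the complement
  have hmem : ((J n : Set T)ᶜ) ∈ 𝓝 (t⁻¹ * s n) := hopen.mem_nhds hnot
  have hmem1 : (fun y => t⁻¹ * s n * y) ⁻¹' ((J n : Set T)ᶜ) ∈ 𝓝 (1 : T) := by
    have hc : Continuous fun y : T => t⁻¹ * s n * y := continuous_const.mul continuous_id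
    exact hc.continuousAt.preimage_mem_nhds (by simpa using hmem)
  obtain ⟨N, -, hN⟩ := hT.basis _ hmem1
  -- choose `m ≥ n, idx N`; then `t ≡ s (idx N) ≡ s m (mod N)` and `s m ≡ s n (mod J n)`
  set m := max n (idx N) with hm
  have ht1 : t⁻¹ * s (idx N) ∈ N.toSubgroup := by
    have := ht N
    change (s (idx N) : T ⧸ N.toSubgroup) = (t : T ⧸ N.toSubgroup) at this
    have h := QuotientGroup.eq.mp this.symm
    exact h
  have ht2 : (s (idx N))⁻¹ * s m ∈ N.toSubgroup :=
    hidx N (coherent_le hanti hs (le_max_right n (idx N)))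
  have ht3 : t⁻¹ * s m ∈ N.toSubgroup := by
    have := N.toSubgroup.mul_mem ht1 ht2
    simpa [mul_assoc] using this
  have h4 : (s n)⁻¹ * s m ∈ J n := coherent_le hanti hs (le_max_left n (idx N))
  -- write `t⁻¹ s n = u · j⁻¹` with `u := t⁻¹ s m ∈ N`, `j := (s n)⁻¹ s m ∈ J n`; then
  -- `y := j u⁻¹ j⁻¹ ∈ N` (normality) and `(t⁻¹ s n) · y = j⁻¹ ∈ J n`, contradicting `N ⊆ P`.
  set u := t⁻¹ * s m with hu
  set j := (s n)⁻¹ * s m with hj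
  have hyN : j * u⁻¹ * j⁻¹ ∈ (N : Set T) :=
    Subgroup.Normal.conj_mem inferInstance _ (N.toSubgroup.inv_mem ht3) j
  have hcontra := hN hyN
  -- `hcontra : t⁻¹ * s n * (j * u⁻¹ * j⁻¹) ∈ (J n)ᶜ`
  apply hcontra
  have e : t⁻¹ * s n * (j * u⁻¹ * j⁻¹) = j⁻¹ := by
    rw [hu, hj]; group
  show t⁻¹ * s n * (j * u⁻¹ * j⁻¹) ∈ (J n : Set T)
  rw [e]
  exact (J n).inv_mem h4

end QuotientIsoSystemLift

end Literature.AnabelianGeometry.SemiGraphs
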